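import Mathlib
import HarnessLib
import Summits.NavierStokesRegularity.NavierStokesRegularity.Theorems.PoloidalWindowDoorLrcModEntireJetCertGauge

/-!
# Route `PoloidalWindowDoor`, item `LrcModEntire` (stmt-NavierStokesRegularity-20428) — certificate checker: POINT-VALUE («gauge value») LETTERS
# (letters whose value AT THE BASE POINT is a prescribed rational, e.g. the rotation–scaling gauge `∂₁u₂(p₀) = 1` of the v4.3 registered stub)

Cell ns-regularity-ideate, seat ns-k2-port-2 g0 (second kernel porter under the LEAD of item 20428, ns-poloidal-K2-p3 g9, who asked for this piece
2026-08-28T06:03Z; `--supports stmt-NavierStokesRegularity-20428`; definitions reviewed).  Generic, no Navier–Stokes content.  Extends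
`…JetCertGauge` (point-ZERO letters) to point-VALUE letters: the registered statement `stub_localTHEmptyHypNUGRS` (twist_split v4.3) carries,
besides the Galilean rest frame `u(p₀) = 0`, the rotation–scaling normal form `∂₀u₂(p₀) = 0`, `∂₁u₂(p₀) = 1` — in cert-1's slice letters
`Rw_1_0 = 0`, `Iw_1_0 = −1/2`.  A hypothesis `X_i(p₀) = c` holds AT the base point only, so (as for zero letters) its sound use is at the LEAF:
a derived law `L` (vanishing on `U`) closes the goal if `L − pins^e`, after the substitution `X_i ↦ c_i` of all value letters, is a sum of monomials
each containing a zero letter — then `pins^e(p₀) = L(p₀) = 0`, contradiction.  Engines therefore certify «`pins^e ∈ ⟨rows⟩ + ⟨zero letters⟩ +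
⟨X_i − c_i⟩`» with NO cofactors for the gauge part.

* `substVal i c p`, `substVals vals p` — substitute rational values for letters in a term list; `ev_substVal`, `ev_substVals`;
* `LocalDatumZV n S M v hyps pins zs vals` — a `LocalDatumZ` whose jet map moreover takes the VALUE `c` at `p₀` in the coordinate `i` for every
  `(i, c) ∈ vals`; `LocalDatumZV.toLocalDatumZ`, `LocalDatumZV.extendS` (chunking), `LocalDatumZV.false_of_leaf` with the Boolean `leafCheckZV`;
* `LocalDatumZV.relabel` — relabeling (`…JetCertRelabel`) carries value letters: a new letter `a` gets the value `c′` when `T a`, after substituting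
  the old values, differs from `c′` by zero-letter-divisible terms (`valsCheck`).

WHAT THIS IS NOT: not a claim about Navier–Stokes and not a certificate. [folklore]
-/

noncomputable section

-- the summit and its single sub-problem share the name (CONVENTIONS §1), as in every Theorems file
set_option linter.dupNamespace false

namespace Summit.NavierStokesRegularity.NavierStokesRegularity.Theorems.PoloidalWindowDoorLrcModEntireJetCertGaugeV

open _root_.Topology _root_.Filter Set
open Literature.Analysis.ValidatedNumerics Literature.Analysis.ValidatedNumerics.QMvPoly
open Literature.Analysis.Calculus.MvPoly
open Summit.NavierStokesRegularity.NavierStokesRegularity.Theorems.PoloidalWindowDoorLrcModEntireJetCertDefs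
open Summit.NavierStokesRegularity.NavierStokesRegularity.Theorems.PoloidalWindowDoorLrcModEntireJetCertMasked
open Summit.NavierStokesRegularity.NavierStokesRegularity.Theorems.PoloidalWindowDoorLrcModEntireJetCertTree
open Summit.NavierStokesRegularity.NavierStokesRegularity.Theorems.PoloidalWindowDoorLrcModEntireJetCertFast2
open Summit.NavierStokesRegularity.NavierStokesRegularity.Theorems.PoloidalWindowDoorLrcModEntireJetCertRelabel
open Summit.NavierStokesRegularity.NavierStokesRegularity.Theorems.PoloidalWindowDoorLrcModEntireJetCertGauge
open Summit.NavierStokesRegularity.NavierStokesRegularity.Theorems.PoloidalWindowDoorLrcModEntireJetLetters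

variable {E : Type*} [NormedAddCommGroup E] [NormedSpace ℝ E] {n : ℕ}

/-! ### Substituting rational values for letters -/

/-- Substitute the rational value `c` for the letter `i` in a term list: `(m, a) ↦ (m with mᵢ := 0, a·c^{mᵢ})`. [folklore] -/
def substVal (i : ℕ) (c : ℚ) (p : QMvPoly) : QMvPoly :=
  p.map fun t => (t.1.set i 0, t.2 * c ^ t.1.getD i 0)

/-- Substitute the values `vals = [(i₁,c₁), …]` (innermost first). [folklore] -/
def substVals (vals : List (ℕ × ℚ)) (p : QMvPoly) : QMvPoly :=
  vals.foldr (fun iv q => substVal iv.1 iv.2 q) p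

/-- Exponents after zeroing one position. [folklore] -/
theorem getD_set_zero : ∀ (m : List ℕ) (i j : ℕ), (m.set i 0).getD j 0 = if j = i then 0 else m.getD j 0
  | [], i, j => by simp
  | a :: m, 0, 0 => by simp
  | a :: m, 0, j + 1 => by simp
  | a :: m, i + 1, 0 => by simp
  | a :: m, i + 1, j + 1 => by
    simp only [List.set_cons_succ, List.getD_cons_succ, getD_set_zero m i j, Nat.add_right_cancel_iff]

/-- **Substitution commutes with evaluation** at points whose `i`-th coordinate IS the substituted value. [folklore] -/
theorem ev_substVal {i : ℕ} (hi : i < n) {c : ℚ} {z : EuclideanSpace ℝ (Fin n)} (hz : z ⟨i, hi⟩ = c) :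
    ∀ p : QMvPoly, ev n (substVal i c p) z = ev n p z := by
  intro p
  induction p with
  | nil => rfl
  | cons t q ih =>
    have hmap : substVal i c (t :: q) = (t.1.set i 0, t.2 * c ^ t.1.getD i 0) :: substVal i c q := rfl
    rw [hmap, ev, toFun_apply, QMvPoly.eval_toMv_cons, ← toFun_apply, ← ev, ih]
    conv_rhs => rw [ev, toFun_apply, QMvPoly.eval_toMv_cons, ← toFun_apply, ← ev]
    congr 1
    set g : Fin n → ℝ := fun j => z j ^ t.1.getD j 0 with hg
    have hupd : (fun j : Fin n => z j ^ (t.1.set i 0).getD j 0) = Function.update g ⟨i, hi⟩ 1 := by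
      funext j
      by_cases hj : j = ⟨i, hi⟩
      · subst hj
        rw [Function.update_self, getD_set_zero, if_pos rfl, pow_zero]
      · have hne : (j : ℕ) ≠ i := fun h => hj (Fin.ext h)
        rw [Function.update_of_ne hj, getD_set_zero, if_neg hne]
    have hL : (∏ j : Fin n, z j ^ (t.1.set i 0).getD j 0) = ∏ j ∈ Finset.univ \ {(⟨i, hi⟩ : Fin n)}, g j := by
      rw [show (∏ j : Fin n, z j ^ (t.1.set i 0).getD j 0) = ∏ j, (fun j : Fin n => z j ^ (t.1.set i 0).getD j 0) j from rfl,
        hupd, Finset.prod_update_of_mem (Finset.mem_univ _), one_mul]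
    have hR : (∏ j : Fin n, z j ^ t.1.getD j 0) = g ⟨i, hi⟩ * ∏ j ∈ Finset.univ \ {(⟨i, hi⟩ : Fin n)}, g j := by
      rw [show (∏ j : Fin n, z j ^ t.1.getD j 0) = ∏ j, Function.update g ⟨i, hi⟩ (g ⟨i, hi⟩) j by rw [Function.update_eq_self],
        Finset.prod_update_of_mem (Finset.mem_univ _)]
    rw [hL, hR]
    have hgj : g ⟨i, hi⟩ = (c : ℝ) ^ t.1.getD i 0 := by
      show z ⟨i, hi⟩ ^ t.1.getD i 0 = (c : ℝ) ^ t.1.getD i 0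
      rw [hz]
    rw [hgj]
    push_cast
    ring

/-- The same for a list of values (every listed index `< n`, the point takes the listed values). [folklore] -/
theorem ev_substVals {vals : List (ℕ × ℚ)} {z : EuclideanSpace ℝ (Fin n)} (hlt : ∀ iv ∈ vals, iv.1 < n)
    (hz : ∀ iv ∈ vals, ∀ hi : iv.1 < n, z ⟨iv.1, hi⟩ = iv.2) :
    ∀ p : QMvPoly, ev n (substVals vals p) z = ev n p z := by
  induction vals with
  | nil => intro p; rfl
  | cons iv vs ih =>
    intro p
    have hstep : substVals (iv :: vs) p = substVal iv.1 iv.2 (substVals vs p) := rfl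
    rw [hstep, ev_substVal (hlt iv (by simp)) (hz iv (by simp) (hlt iv (by simp))),
      ih (fun jv h => hlt jv (by simp [h])) (fun jv h => hz jv (by simp [h]))]

/-! ### Local data with point-zero and point-value letters -/

/-- **A LOCAL DATUM WITH POINT-ZERO AND POINT-VALUE LETTERS**: a `LocalDatumZ` whose jet map moreover takes the rational value `c` AT the base
point in the coordinate `i`, for every `(i, c) ∈ vals`. [folklore] -/
def LocalDatumZV (n : ℕ) (S : ℕ → ℕ → QMvPoly) (M : ℕ → ℕ → Bool) (v : ℕ → E) (hyps pins : List QMvPoly) (zs : List ℕ)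
    (vals : List (ℕ × ℚ)) : Prop :=
  ∃ (U : Set E) (p₀ : E) (g : E → EuclideanSpace ℝ (Fin n)), IsOpen U ∧ p₀ ∈ U ∧ (∀ x ∈ U, DifferentiableAt ℝ g x) ∧
    (∀ j, ∀ i : Fin n, M j i = true → ∀ x ∈ U, fderiv ℝ (fun y => g y i) x (v j) = ev n (S j i) (g x)) ∧
    (∀ L ∈ hyps, ∀ x ∈ U, ev n L (g x) = 0) ∧ (∀ π ∈ pins, ev n π (g p₀) ≠ 0) ∧ (∀ i ∈ zs, ∀ hi : i < n, g p₀ ⟨i, hi⟩ = 0) ∧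
    (∀ iv ∈ vals, ∀ hi : iv.1 < n, g p₀ ⟨iv.1, hi⟩ = (iv.2 : ℝ))

/-- Forgetting the value letters. [folklore] -/
theorem LocalDatumZV.toLocalDatumZ {S : ℕ → ℕ → QMvPoly} {M : ℕ → ℕ → Bool} {v : ℕ → E} {hyps pins : List QMvPoly} {zs : List ℕ}
    {vals : List (ℕ × ℚ)} (h : LocalDatumZV (E := E) n S M v hyps pins zs vals) : LocalDatumZ (E := E) n S M v hyps pins zs := by
  obtain ⟨U, p₀, g, hU, hp₀, hg, hS, hh, hp, hz, _⟩ := h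
  exact ⟨U, p₀, g, hU, hp₀, hg, hS, hh, hp, hz⟩

/-- A datum with zero letters is one with no value letters. [folklore] -/
theorem LocalDatumZV.of_localDatumZ {S : ℕ → ℕ → QMvPoly} {M : ℕ → ℕ → Bool} {v : ℕ → E} {hyps pins : List QMvPoly} {zs : List ℕ}
    (h : LocalDatumZ (E := E) n S M v hyps pins zs) : LocalDatumZV (E := E) n S M v hyps pins zs [] := by
  obtain ⟨U, p₀, g, hU, hp₀, hg, hS, hh, hp, hz⟩ := h
  exact ⟨U, p₀, g, hU, hp₀, hg, hS, hh, hp, hz, fun iv hiv => by simp at hiv⟩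

/-- **CHUNKING** with zero and value letters: a certified law joins the hypotheses. [folklore] -/
theorem LocalDatumZV.extendS {S : ℕ → ℕ → QMvPoly} {M : ℕ → ℕ → Bool} {v : ℕ → E} {hyps pins : List QMvPoly} {zs : List ℕ}
    {vals : List (ℕ × ℚ)} (hdat : LocalDatumZV (E := E) n S M v hyps pins zs vals) {cert : List (List (QMvPoly × ℕ × List ℕ))} {k : ℕ}
    {T : QMvPoly} (hcheck : certCheckS n S M hyps cert k T = true) : LocalDatumZV (E := E) n S M v (hyps ++ [T]) pins zs vals := by
  obtain ⟨U, p₀, g, hU, hp₀, hg, hS, hhyps, hpins, hz, hv⟩ := hdat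
  refine ⟨U, p₀, g, hU, hp₀, hg, hS, ?_, hpins, hz, hv⟩
  intro L hL x hx
  rcases List.mem_append.1 hL with h | h
  · exact hhyps L h x hx
  · rw [List.mem_singleton.1 h]; exact ev_eq_zero_of_certCheckS hU hg hS hhyps hcheck x hx

/-- **THE VALUE-GAUGED LEAF CHECK**: every value index is `< n`; derive the laws of `steps` from `hyps`; the `k`-th law minus the pin monomial
`pins^e`, AFTER substituting the values, must be term-wise divisible by the point-zero letters `zs` (Boolean). [folklore] -/
def leafCheckZV (n : ℕ) (S : ℕ → ℕ → QMvPoly) (M : ℕ → ℕ → Bool) (hyps pins : List QMvPoly) (zs : List ℕ) (vals : List (ℕ × ℚ))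
    (steps : List (List (QMvPoly × ℕ × List ℕ))) (k : ℕ) (e : List ℕ) : Bool :=
  (vals.all fun iv => decide (iv.1 < n)) &&
  match deriveS n S M hyps steps with
  | none => false
  | some laws => allZeroDiv n zs (normalizeS (substVals vals (laws.getD k [] ++ QMvPoly.smul (-1) (pinProduct pins e))))

/-- **SOUNDNESS OF THE VALUE-GAUGED LEAF**: a datum with zero and value letters is refuted by a derivation whose `k`-th law equals a pin
monomial up to terms vanishing at the base point after the value substitution. [folklore] -/
theorem LocalDatumZV.false_of_leaf {S : ℕ → ℕ → QMvPoly} {M : ℕ → ℕ → Bool} {v : ℕ → E} {hyps pins : List QMvPoly} {zs : List ℕ}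
    {vals : List (ℕ × ℚ)} (hdat : LocalDatumZV (E := E) n S M v hyps pins zs vals) {steps : List (List (QMvPoly × ℕ × List ℕ))} {k : ℕ}
    {e : List ℕ} (hcheck : leafCheckZV n S M hyps pins zs vals steps k e = true) : False := by
  obtain ⟨U, p₀, g, hU, hp₀, hg, hS, hhyps, hpins, hz, hv⟩ := hdat
  simp only [leafCheckZV, Bool.and_eq_true, List.all_eq_true, decide_eq_true_eq] at hcheck
  obtain ⟨hlt, hcheck⟩ := hcheck
  cases hd : deriveS n S M hyps steps with
  | none => simp [hd] at hcheck
  | some laws =>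
    simp only [hd] at hcheck
    have hlaw : ev n (laws.getD k []) (g p₀) = 0 := by
      rw [List.getD_eq_getElem?_getD]
      cases h : laws[k]? with
      | none => simp
      | some L => simpa using ev_deriveS_eq_zero hU hg hS steps hyps hhyps laws hd L (List.mem_of_getElem? h) p₀ hp₀
    have h0 := ev_eq_zero_of_allZeroDiv (z := g p₀) hz _ hcheck
    rw [ev_normalizeS, ev_substVals hlt hv, ev_append, ev_smul, hlaw] at h0
    have hπ : ev n (pinProduct pins e) (g p₀) = 0 := by
      have : ((-1 : ℚ) : ℝ) * ev n (pinProduct pins e) (g p₀) = 0 := by simpa using h0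
      simpa using this
    exact ev_pinProduct_ne_zero (g p₀) pins e hpins hπ

/-! ### Relabeling with point-zero and point-value letters -/

/-- New value letters: every old value index is `< n`, and each listed new letter `a < m` has `T a − c′`, after substituting the old values,
term-wise divisible by the old zero letters (Boolean). [folklore] -/
def valsCheck (n : ℕ) (R : RelabelData) (zs : List ℕ) (vals vals' : List (ℕ × ℚ)) : Bool :=
  (vals.all fun iv => decide (iv.1 < n)) &&
  vals'.all fun ac => decide (ac.1 < R.m) && allZeroDiv n zs (normalizeS (substVals vals (R.Tf ac.1 ++ QMvPoly.const (-ac.2))))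

/-- **RELABELING A LOCAL DATUM WITH ZERO AND VALUE LETTERS** (same construction as `…JetCertGauge.LocalDatumZ.relabel`). [folklore] -/
theorem LocalDatumZV.relabel {S : ℕ → ℕ → QMvPoly} {M : ℕ → ℕ → Bool} {v : ℕ → E} {hyps pins : List QMvPoly} {zs : List ℕ}
    {vals : List (ℕ × ℚ)} (R : RelabelData) (zs' : List ℕ) (vals' : List (ℕ × ℚ)) (hc : relabelCheck n S M hyps pins R = true)
    (hzc : zerosCheck n R zs zs' = true) (hvc : valsCheck n R zs vals vals' = true)
    (hdat : LocalDatumZV (E := E) n S M v hyps pins zs vals) : LocalDatumZV (E := E) R.m R.Sf R.Mf v R.hyps' R.pins' zs' vals' := by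
  have hZ : LocalDatumZ (E := E) n S M v hyps pins zs := hdat.toLocalDatumZ
  obtain ⟨U, p₀, g, hU, hp₀, hg, hS, hhyps, hpins, hz, hv⟩ := hdat
  simp only [relabelCheck, Bool.and_eq_true, List.all_eq_true, List.mem_range, Bool.or_eq_true, Bool.not_eq_true',
    decide_eq_true_eq] at hc
  obtain ⟨⟨htab, hhyp⟩, hlen, hpin⟩ := hc
  set g' : E → EuclideanSpace ℝ (Fin R.m) := fun x => subPoint R.m R.Tf (g x) with hg'
  have hcoord : ∀ (a : Fin R.m) (x : E), g' x a = ev n (R.Tf a) (g x) := fun a x => by simp [hg']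
  have hdiffc : ∀ (p : QMvPoly) (x : E), x ∈ U → DifferentiableAt ℝ (fun y => ev n p (g y)) x := fun p x hx =>
    ((differentiable_toFun (QMvPoly.toMv ℝ n p)) _).comp x (hg x hx)
  have hg'd : ∀ x ∈ U, DifferentiableAt ℝ g' x := fun x hx => by
    rw [hg']
    exact differentiableAt_mkJet fun a => hdiffc _ x hx
  refine ⟨U, p₀, g', hU, hp₀, hg'd, ?_, ?_, ?_, ?_, ?_⟩
  · intro j a hM x hx
    have hj : j < R.M'.length := by
      by_contra hj'
      have : R.Mf j a = false := by
        simp [RelabelData.Mf, List.getD_eq_getElem?_getD, List.getElem?_eq_none (not_lt.1 hj')]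
      rw [this] at hM; exact Bool.false_ne_true hM
    have h := htab j hj a a.isLt
    rcases h with h | ⟨huse, hcert⟩
    · rw [h] at hM; exact (Bool.false_ne_true hM).elim
    have hfun : (fun y => g' y a) = fun y => ev n (R.Tf a) (g y) := funext fun y => hcoord a y
    rw [hfun, fderiv_ev_eq_ev_tderiv_masked (hg x hx) (fun i hi => hS j i hi x hx) huse]
    have h0 := ev_eq_zero_of_certCheckS hU hg (hS) hhyps hcert x hx
    rw [ev_subQ, sub_eq_zero] at h0
    rw [h0, ev_compQ]
  · intro L hL x hx
    obtain ⟨i, hi, rfl⟩ := List.getElem_of_mem hL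
    have h := hhyp i hi
    have h0 := ev_eq_zero_of_certCheckS hU hg hS hhyps h x hx
    rw [List.getD_eq_getElem?_getD, List.getElem?_eq_getElem hi, Option.getD_some, ev_compQ] at h0
    simpa [hg'] using h0
  · intro π hπ
    obtain ⟨i, hi, rfl⟩ := List.getElem_of_mem hπ
    have h := hpin i hi
    have h0 := ev_eq_zero_of_certCheckS hU hg hS hhyps h p₀ hp₀
    rw [ev_subQ, sub_eq_zero, List.getD_eq_getElem?_getD, List.getElem?_eq_getElem hi, Option.getD_some, ev_compQ] at h0
    show ev R.m (R.pins'[i]) (subPoint R.m R.Tf (g p₀)) ≠ 0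
    rw [h0]
    exact ev_pinProduct_ne_zero (g p₀) pins _ hpins
  · intro a ha ham
    simp only [zerosCheck, List.all_eq_true, Bool.and_eq_true, decide_eq_true_eq] at hzc
    obtain ⟨_, hdiv⟩ := hzc a ha
    show g' p₀ ⟨a, ham⟩ = 0
    rw [hcoord ⟨a, ham⟩ p₀]
    exact ev_eq_zero_of_allZeroDiv hz _ hdiv
  · intro ac hac ham
    simp only [valsCheck, List.all_eq_true, Bool.and_eq_true, decide_eq_true_eq] at hvc
    obtain ⟨hlt, hall⟩ := hvc
    obtain ⟨_, hdiv⟩ := hall ac hac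
    show g' p₀ ⟨ac.1, ham⟩ = (ac.2 : ℝ)
    rw [hcoord ⟨ac.1, ham⟩ p₀]
    have h0 := ev_eq_zero_of_allZeroDiv hz _ hdiv
    rw [ev_normalizeS, ev_substVals hlt hv, ev_append] at h0
    have hc : ev n (QMvPoly.const (-ac.2)) (g p₀) = ((-ac.2 : ℚ) : ℝ) := by
      simp [ev, QMvPoly.toMv_const, toFun_apply]
    rw [hc] at h0
    push_cast at h0
    linarith

/-! ### Dense-constant variant of the value transfer (use THIS with `mkPoly` / dictionary letters) -/

/-- **Dense-constant value transfer check** (the one to use with dictionary letters): as `valsCheck`, but the constant `c′` carries the DENSE zero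
exponent vector `List.replicate n 0` — the term lists of `mkPoly n …` and of the slice dictionaries are dense of length `n` and `normalizeS` merges
only syntactically equal exponent lists, so with `QMvPoly.const` (exponent list `[]`) the difference `T a − c′` would never normalise. [folklore] -/
def valsCheckD (n : ℕ) (R : RelabelData) (zs : List ℕ) (vals vals' : List (ℕ × ℚ)) : Bool :=
  (vals.all fun iv => decide (iv.1 < n)) &&
  vals'.all fun ac => decide (ac.1 < R.m) && allZeroDiv n zs (normalizeS (substVals vals (R.Tf ac.1 ++ [(List.replicate n 0, -ac.2)])))

/-- **RELABELING A LOCAL DATUM WITH ZERO AND VALUE LETTERS, dense-constant check** (same construction as `LocalDatumZV.relabel`). [folklore] -/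
theorem LocalDatumZV.relabelD {S : ℕ → ℕ → QMvPoly} {M : ℕ → ℕ → Bool} {v : ℕ → E} {hyps pins : List QMvPoly} {zs : List ℕ}
    {vals : List (ℕ × ℚ)} (R : RelabelData) (zs' : List ℕ) (vals' : List (ℕ × ℚ)) (hc : relabelCheck n S M hyps pins R = true)
    (hzc : zerosCheck n R zs zs' = true) (hvc : valsCheckD n R zs vals vals' = true)
    (hdat : LocalDatumZV (E := E) n S M v hyps pins zs vals) : LocalDatumZV (E := E) R.m R.Sf R.Mf v R.hyps' R.pins' zs' vals' := by
  have hZ : LocalDatumZ (E := E) n S M v hyps pins zs := hdat.toLocalDatumZ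
  obtain ⟨U, p₀, g, hU, hp₀, hg, hS, hhyps, hpins, hz, hv⟩ := hdat
  simp only [relabelCheck, Bool.and_eq_true, List.all_eq_true, List.mem_range, Bool.or_eq_true, Bool.not_eq_true',
    decide_eq_true_eq] at hc
  obtain ⟨⟨htab, hhyp⟩, hlen, hpin⟩ := hc
  set g' : E → EuclideanSpace ℝ (Fin R.m) := fun x => subPoint R.m R.Tf (g x) with hg'
  have hcoord : ∀ (a : Fin R.m) (x : E), g' x a = ev n (R.Tf a) (g x) := fun a x => by simp [hg']
  have hdiffc : ∀ (p : QMvPoly) (x : E), x ∈ U → DifferentiableAt ℝ (fun y => ev n p (g y)) x := fun p x hx =>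
    ((differentiable_toFun (QMvPoly.toMv ℝ n p)) _).comp x (hg x hx)
  have hg'd : ∀ x ∈ U, DifferentiableAt ℝ g' x := fun x hx => by
    rw [hg']
    exact differentiableAt_mkJet fun a => hdiffc _ x hx
  refine ⟨U, p₀, g', hU, hp₀, hg'd, ?_, ?_, ?_, ?_, ?_⟩
  · intro j a hM x hx
    have hj : j < R.M'.length := by
      by_contra hj'
      have : R.Mf j a = false := by
        simp [RelabelData.Mf, List.getD_eq_getElem?_getD, List.getElem?_eq_none (not_lt.1 hj')]
      rw [this] at hM; exact Bool.false_ne_true hM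
    have h := htab j hj a a.isLt
    rcases h with h | ⟨huse, hcert⟩
    · rw [h] at hM; exact (Bool.false_ne_true hM).elim
    have hfun : (fun y => g' y a) = fun y => ev n (R.Tf a) (g y) := funext fun y => hcoord a y
    rw [hfun, fderiv_ev_eq_ev_tderiv_masked (hg x hx) (fun i hi => hS j i hi x hx) huse]
    have h0 := ev_eq_zero_of_certCheckS hU hg (hS) hhyps hcert x hx
    rw [ev_subQ, sub_eq_zero] at h0
    rw [h0, ev_compQ]
  · intro L hL x hx
    obtain ⟨i, hi, rfl⟩ := List.getElem_of_mem hL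
    have h := hhyp i hi
    have h0 := ev_eq_zero_of_certCheckS hU hg hS hhyps h x hx
    rw [List.getD_eq_getElem?_getD, List.getElem?_eq_getElem hi, Option.getD_some, ev_compQ] at h0
    simpa [hg'] using h0
  · intro π hπ
    obtain ⟨i, hi, rfl⟩ := List.getElem_of_mem hπ
    have h := hpin i hi
    have h0 := ev_eq_zero_of_certCheckS hU hg hS hhyps h p₀ hp₀
    rw [ev_subQ, sub_eq_zero, List.getD_eq_getElem?_getD, List.getElem?_eq_getElem hi, Option.getD_some, ev_compQ] at h0
    show ev R.m (R.pins'[i]) (subPoint R.m R.Tf (g p₀)) ≠ 0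
    rw [h0]
    exact ev_pinProduct_ne_zero (g p₀) pins _ hpins
  · intro a ha ham
    simp only [zerosCheck, List.all_eq_true, Bool.and_eq_true, decide_eq_true_eq] at hzc
    obtain ⟨_, hdiv⟩ := hzc a ha
    show g' p₀ ⟨a, ham⟩ = 0
    rw [hcoord ⟨a, ham⟩ p₀]
    exact ev_eq_zero_of_allZeroDiv hz _ hdiv
  · intro ac hac ham
    simp only [valsCheckD, List.all_eq_true, Bool.and_eq_true, decide_eq_true_eq] at hvc
    obtain ⟨hlt, hall⟩ := hvc
    obtain ⟨_, hdiv⟩ := hall ac hac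
    show g' p₀ ⟨ac.1, ham⟩ = (ac.2 : ℝ)
    rw [hcoord ⟨ac.1, ham⟩ p₀]
    have h0 := ev_eq_zero_of_allZeroDiv hz _ hdiv
    rw [ev_normalizeS, ev_substVals hlt hv, ev_append] at h0
    have h1 : (∏ j : Fin n, (g p₀) j ^ (List.replicate n 0).getD j 0) = 1 :=
      Finset.prod_eq_one fun j _ => by
        rw [List.getD_eq_getElem?_getD, List.getElem?_replicate, if_pos j.isLt, Option.getD_some, pow_zero]
    have hc : ev n [(List.replicate n 0, -ac.2)] (g p₀) = ((-ac.2 : ℚ) : ℝ) := by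
      rw [ev, toFun_apply, QMvPoly.eval_toMv_cons, ← toFun_apply, ← ev, ev_nil, add_zero, h1, mul_one]
    rw [hc] at h0
    push_cast at h0
    linarith

end Summit.NavierStokesRegularity.NavierStokesRegularity.Theorems.PoloidalWindowDoorLrcModEntireJetCertGaugeV

end
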